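import Summits.BirchSwinnertonDyer.BirchSwinnertonDyer.Theorems.SchneiderFreeAdditiveX3ControlLeMinimal
import Summits.BirchSwinnertonDyer.BirchSwinnertonDyer.Theorems.ClassRecordThreeStepLOfHalvesB
import Summits.BirchSwinnertonDyer.BirchSwinnertonDyer.Theorems.SchneiderFreeAdditiveX3StepLEquivBranch
import HarnessLib

/-!
# The anticyclotomic control INEQUALITY (`AdditiveControlLeOnTreeAt … 0`) and CTL₀ at EVERY additive prime `p ≠ 2`
# split in an imaginary quadratic `K`, from Poitou–Tate duality for Selmer structures and rank one ONLY —
# no reduction-type hypothesis at `p`, no `poitouTate_sha_tateDual`, no Fin_v, no Serre 1967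

Cell `bsd-wall` (W-ALL row 2·3@3, lane 3), seat `bsd-wall-utd-p3` (prover, gen 6), 2026-08-28. Route-free
(no `Theses.*` declaration is used; the K1 door's `…ControlLeMinimal` is imported for its glue only).

WHY. The pointwise control EQUALITY `SchneiderFree.AdditiveControlOnTreeAt` (crux #5 `WildSplitControlAtThree`
of route `UniversalToricDescent`, stmt-BirchSwinnertonDyer-20386; the K1 door's crux `AnticycControlAdditiveK`)
is, on the wild cell, CLOSED MODULO exactly two cited facts: `poitouTate_selmerStructure_duality` (PT1, 20461)
and `poitouTate_sha_tateDual` (PT2, 20462) (`UniversalToricDescentControl.wildSplitControlAtThree_of_poitouTate`,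
utd-p3 g5). In the K1 door PT2 is consumed ONLY by the coinvariant atom (L10) — the `≥` direction of control
(door-c4 gen 4, `additiveControlLeOnTreeAt_of_pt_of_kolyvagin`, p448348); the `≤` direction and CTL₀ need
PT1 and the rank-one inputs only. That theorem is stated with the K1 door's cell hypotheses (`ClassX3`,
`Additive.N10.Locus`, `Additive.SubSemistableTwist` — potentially ORDINARY `p`). None of them is used by its
proof: the ingredients (`additiveControlLeOnTreeAt_of_torsAtomsLe'`, the torsion-robust base count
`additiveBaseSelmerCountTors_of_rankOne_anyTorsion`, the Poitou–Tate lift `ptSurj_of_finite` at the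
CONJUGATE prime, `finite_selmerAcBase_of_rankOne_anyTorsion`) ask only `Addv W p`, `p ≠ 2`, `K` imaginary
quadratic with `p` split and `p ∤ #𝓞_K^×`, `rank E(K) = 1`, `Ш(E/K)` finite, a point of infinite order.

WHAT (theorems only; CONDITIONAL on PT1 as a hypothesis BY NAME; no definition, no named fact, no `sorry`):
* §1 `additiveControlLeOnTreeAt_of_poitouTate_of_rankOne` — at EVERY anticyclotomic frame `(κ, γ, 𝔭)` of
  degree one: `AdditiveControlLeOnTreeAt p κ 𝔭 γ (embAt K p 𝔭) 0 P`
  (`ord_p f(0) ≤ ord_p #Ш(E/K)[p^∞] + 2·(ord_p log_ω P − ord_p [E(K):ℤP]) + ord_p ∏_{w ∣ N⁺} c_w`), ANY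
  reduction type at the additive `p` (potentially supersingular / wild `3` included); and CTL₀
  `exists_hasCharValuationAt_of_poitouTate_of_rankOne` (`X_ac^∅(E_K[p^∞])` is `Λ`-torsion with `f(0) ≠ 0`).
* §2 `additiveControlLeOnTreeAt_of_poitouTate_of_heegner` — the same in Heegner-datum binders (Kolyvagin's
  theorem for the datum as antecedent `kolyvagin N W K`; `p ∤ #𝓞_K^×` and `p` split are automatic for
  `p ∣ N` at a Heegner field, `X11b.Three.not_dvd_discr_and_not_dvd_torsionOrder_of_heegner`).
* §3 `index_le_of_imcLowerLe_of_controlLe`, `indexLowerBoundLeAt_of_imcLowerLe_of_controlLe` — the STEP L link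
  re-run with `≤`: T-B6-1 at slack `s` + the control INEQUALITY at slack `t` give
  `SchneiderFree.IndexLowerBoundLeAt W p K P (s + t)` (over a Heegner field, `Ш(E/K)` finite). The UTD kernel
  (`ToricKernelAtThree`, 20390) reads its HARD half (STEP L at the Manin slack) through this link.

HONEST FRAMING: closes nothing by itself; BSD is not proved for any curve; PT1 (Milne *ADT* I Thm. 4.10(b) /
Howard 2004 Thm. 2.1.11) stays a hypothesis (cell bsd-schneider-ideate's line); the `≥` half of control (hence
the control EQUALITY and the UPPER index socket) still needs PT2.

References: [JetchevSkinnerWan2017] Thm. 3.3.1, Prop. 3.2.1, Prop. 3.3.2, §7.4.1 (arXiv:1512.06894 pp. 10–14,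
30); [GreenbergLNM1716] §3 Lemma 3.3, §4 Lemma 4.2; [Castella2018] Thm. 2.3; [MilneADT2006] I Thm. 2.8,
Thm. 4.10(b); [Howard2004HeegnerKolyvagin] Thm. 2.1.11; [Kolyvagin1990] Thm. A; [GrossLMS1991] §2.
-/

noncomputable section

open scoped Classical

open Field NumberField IsDedekindDomain WeierstrassCurve
open Literature.NumberTheory.EllipticCurves Literature.NumberTheory.EllipticCurves.GreenbergSelmer
open Literature.NumberTheory.GaloisRepresentations
open Literature.NumberTheory.GaloisCohomology
open Literature.NumberTheory.EllipticCurves.ModularForms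
  Literature.NumberTheory.EllipticCurves.Rank1Residual
  Literature.NumberTheory.EllipticCurves.Rank1Residual.Typed
  Summit.BirchSwinnertonDyer.Rank1Residual
  Summit.BirchSwinnertonDyer.Rank1Residual.X11b
  Summit.BirchSwinnertonDyer.Rank1Residual.X11b.AcSelmer
  Summit.BirchSwinnertonDyer.Rank1Residual.X11b.LocBridge
  Summit.BirchSwinnertonDyer.BirchSwinnertonDyer.Theorems.SchneiderFree
  Summit.BirchSwinnertonDyer.BirchSwinnertonDyer.Theorems.SchneiderFreeControlAtoms
  Summit.BirchSwinnertonDyer.BirchSwinnertonDyer.Theorems.SchneiderFreeAdditiveX3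

set_option linter.dupNamespace false
set_option autoImplicit false

namespace Summit.BirchSwinnertonDyer.BirchSwinnertonDyer.Theorems.AdditiveRankOneControlLe

/-! ## §1. The control inequality and CTL₀ at every frame from PT1 and rank one -/

section RankOne

variable (W : WeierstrassCurve ℚ) [W.IsElliptic] [W.IsGloballyMinimal] (p : ℕ) [Fact p.Prime]
  {K : Type} [Field K] [NumberField K]

/-- **The anticyclotomic control INEQUALITY at an additive prime, ANY reduction type, from Poitou–Tate
duality for Selmer structures and rank one ONLY.** For `W/ℚ` globally minimal additive at the odd prime `p`,
`K` imaginary quadratic with `p` split and `p ∤ #𝓞_K^×`, `rank E(K) = 1`, `Ш(E/K)` finite, `P ∈ E(K)` of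
infinite order, every anticyclotomic `ℤ_p`-extension `κ` with topological generator `γ` and every degree-one
`𝔭 ∣ p`: `ord_p f(0) ≤ ord_p #Ш(E/K)[p^∞] + 2·(ord_p log_ω P − ord_p [E(K):ℤP]) + ord_p ∏_{w ∣ N⁺} c_w(E/K)`
for THE characteristic generator `f` of `X_ac^∅(E_K[p^∞])` (which exists: CTL₀ is part of the conclusion).
Proof = door-c4 gen 4's `additiveControlLeOnTreeAt_of_pt_of_kolyvagin` with the K1 cell hypotheses removed:
`#E(K_∞)[p^∞]^{fixed}` finite (`p ∤ #μ(K)`), local kernel at `𝔭` of order `≤ #E(ℚ_p)[p^∞] = p^{t_p}`,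
the torsion-robust base count `#Sel_𝔭(K)·p^{t_p} = p^a`, and the Poitou–Tate lift at `{𝔭} ∪ Σ(N⁺)` from
PT1 and the finiteness of `Sel_𝔭̄(K)` at the CONJUGATE prime (rank one again). No `poitouTate_sha_tateDual`,
no Fin_v, no Serre 1967, no hypothesis on `E(K)[p]` or `E(ℚ_p)[p]`.
[cite: JetchevSkinnerWan2017, Thm. 3.3.1 and Prop. 3.3.2 (arXiv:1512.06894 pp. 11–13)]
[cite: MilneADT2006, Ch. I, Thm. 4.10(b)] [cite: GreenbergLNM1716, §3 Lemma 3.3 (p. 87) and §4 Lemma 4.2 (p. 102)] -/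
theorem additiveControlLeOnTreeAt_of_poitouTate_of_rankOne (hp2 : p ≠ 2) (hadd : Addv W p)
    (hPT : poitouTate_selmerStructure_duality K) (hK : IsImaginaryQuadratic K) (hsplit : SplitsIn K p)
    (hunit : ¬ p ∣ Units.torsionOrder K) (hrank : (W.baseChange K).mordellWeilRank = 1)
    (hSha : (W.baseChange K).ShaFinite) (P : (W.baseChange K).toAffine.Point) (hnt : ¬ IsOfFinAddOrder P)
    (κ : ZpExtension K p) (hκ : κ.IsAnticyclotomic) (γ : Field.absoluteGaloisGroup K)
    [Fact (κ.IsTopGenerator γ)] (𝔭 : HeightOneSpectrum (𝓞 K)) (h𝔭 : ((p : ℕ) : 𝓞 K) ∈ 𝔭.asIdeal)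
    (he : 𝔭.asIdeal.ramificationIdx (𝓞 ℚ) = 1) (hf : 𝔭.asIdeal.inertiaDeg (𝓞 ℚ) = 1) :
    AdditiveControlLeOnTreeAt p κ 𝔭 γ (embAt K p 𝔭 h𝔭 he hf) 0 P := by
  have hp : p.Prime := Fact.out
  haveI : IsTotallyComplex K := hK.2
  haveI hEK : (W.baseChange K).IsElliptic := by rw [baseChange]; infer_instance
  have hpN : p ∣ W.conductorNorm ℤ :=
    (W.dvd_conductorNorm_iff_not_hasGoodReductionAtPrime p).mpr (not_good_of_addv W p hadd)
  -- global torsion over the tower: `#ker res = p^g`, finite since `p ∤ #μ(K)`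
  set g := padicValNat p (Nat.card (AddCommGroup.primaryComponent (W.baseChange K).toAffine.Point p))
    with hgdef
  have hcardg := SchneiderFreeAdditiveX3.natCard_primaryComponent_point_eq_pow (W.baseChange K) p
  haveI := finite_fixedPoints_kerSubgroup_of_not_dvd_torsionOrder W p κ hp2 hK hunit hκ
  have hres : Nat.card ((W.baseChange K).resOfLe p (le_top : κ.kerSubgroup ≤ ⊤)).ker = p ^ g := by
    rw [natCard_ker_resOfLe_top_eq_natCard_fixedPoints (W.baseChange K) p κ,
      natCard_fixedPoints_geomPrimaryTorsion_eq_natCard_primaryComponent (W.baseChange K) p, hcardg]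
  -- local torsion at `𝔭`: `#ker r_𝔭 ≤ #E(ℚ_p)[p^∞] = p^{t_p}` (no Fin_v)
  obtain ⟨tp, htp⟩ := exists_natCard_primaryComponent_padic_eq_pow W p
  obtain ⟨hfin𝔭, hle𝔭⟩ := natCard_localKer_le_natCard_primaryComponent_padic W p κ 𝔭 h𝔭 he hf
  rw [htp] at hle𝔭
  -- the torsion-robust base count `#Sel_𝔭(K)·p^{t_p} = p^a` (PT1 + rank one)
  obtain ⟨hfinS, a, hcard, ha⟩ := additiveBaseSelmerCountTors_of_rankOne_anyTorsion W p K hPT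
    (fun v ↦ localEulerPoincareCharacteristic_adicCompletionEP K v) hadd hK hsplit hrank hSha P hnt
    𝔭 h𝔭 he hf
  have hcard' : Nat.card (selmerAcBase (W.baseChange K) p 𝔭 ∅) * p ^ tp = p ^ a := by
    rw [← htp]; exact hcard
  have hle : tp ≤ a :=
    (Nat.pow_dvd_pow_iff_le_right hp.one_lt).mp ⟨_, by rw [mul_comm]; exact hcard'.symm⟩
  have hcardSel : Nat.card (selmerAcBase (W.baseChange K) p 𝔭 ∅) = p ^ (a - tp) := by
    have hsplitpow : p ^ a = p ^ (a - tp) * p ^ tp := by rw [← pow_add, Nat.sub_add_cancel hle]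
    rw [hsplitpow] at hcard'
    exact Nat.eq_of_mul_eq_mul_right (pow_pos hp.pos tp) hcard'
  -- the Poitou–Tate lift at `{𝔭} ∪ Σ(N⁺)`: PT1 + finiteness of `Sel_𝔮(K)` at the CONJUGATE prime `𝔮`
  obtain ⟨𝔮, hne, h𝔮, he𝔮, hf𝔮⟩ := X11b.Three.exists_ne_degreeOne_prime hK.1 h𝔭 he hf
  have hfin𝔮 : Finite (selmerAcBase (W.baseChange K) p 𝔮 ∅) :=
    finite_selmerAcBase_of_rankOne_anyTorsion W p K
      (poitouTate_sum_localTatePairing_eq_zero_of_selmerStructure_duality hPT) hK hsplit hrank hSha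
      𝔮 h𝔮 he𝔮 hf𝔮
  have hloc := ptSurj_of_finite W p hK hsplit hPT h𝔭 h𝔮 hne hfin𝔮 κ
  refine additiveControlLeOnTreeAt_of_torsAtomsLe' (W := W) hK hsplit hpN hκ γ 𝔭 h𝔭
    (embAt K p 𝔭 h𝔭 he hf) P g tp (a - tp) hres hfin𝔭 hle𝔭 ⟨⟨hfinS, hcardSel⟩, ?_⟩ hloc
  rw [Nat.cast_sub hle, ha]

/-- **CTL₀ at every frame from PT1 and rank one** (any reduction type at the additive `p`): the Pontryagin
dual `X_ac^∅(E_K[p^∞])` over the anticyclotomic tower is `Λ`-torsion with a characteristic generator of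
NON-ZERO constant term. [cite: GreenbergLNM1716, §4 Lemma 4.2 (p. 102)] [cite: Castella2018, Thm. 2.3 (arXiv:1704.06608 p. 5)] -/
theorem exists_hasCharValuationAt_of_poitouTate_of_rankOne (hp2 : p ≠ 2) (hadd : Addv W p)
    (hPT : poitouTate_selmerStructure_duality K) (hK : IsImaginaryQuadratic K) (hsplit : SplitsIn K p)
    (hunit : ¬ p ∣ Units.torsionOrder K) (hrank : (W.baseChange K).mordellWeilRank = 1)
    (hSha : (W.baseChange K).ShaFinite) (P : (W.baseChange K).toAffine.Point) (hnt : ¬ IsOfFinAddOrder P)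
    (κ : ZpExtension K p) (hκ : κ.IsAnticyclotomic) (γ : Field.absoluteGaloisGroup K)
    [Fact (κ.IsTopGenerator γ)] (𝔭 : HeightOneSpectrum (𝓞 K)) (h𝔭 : ((p : ℕ) : 𝓞 K) ∈ 𝔭.asIdeal) :
    ∃ n : ℕ, XAc.HasCharValuationAt (W.baseChange K) p κ 𝔭 ∅ γ n := by
  obtain ⟨he, hf⟩ := degreeOne_of_splitsIn hK.1 hsplit h𝔭
  obtain ⟨n, hn, -⟩ := additiveControlLeOnTreeAt_of_poitouTate_of_rankOne W p hp2 hadd hPT hK hsplit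
    hunit hrank hSha P hnt κ hκ γ 𝔭 h𝔭 he hf
  exact ⟨n, hn⟩

end RankOne

/-! ## §2. The Heegner-datum form (Kolyvagin's theorem for the datum as antecedent) -/

section Heegner

variable (W : WeierstrassCurve ℚ) [W.IsElliptic] [W.IsGloballyMinimal] (p : ℕ) [Fact p.Prime]

/-- **The control INEQUALITY at every frame of a Heegner datum of an additive curve, from PT1 ALONE** (the
rank-one inputs being Kolyvagin's theorem `kolyvagin N W K` for the datum, an antecedent). For `W` additive
at the odd `p`, `N = N(E)`, `K` imaginary quadratic Heegner for `N` (so `p ∣ N` splits and `p ∤ #𝓞_K^×`), a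
Heegner point `P` of infinite order: at every anticyclotomic frame `(κ, γ, 𝔭)` of degree one,
`AdditiveControlLeOnTreeAt p κ 𝔭 γ (embAt K p 𝔭) 0 P`. This is the `≤` HALF of the K1/UTD control cruxes in
their own binders, with NO reduction-type hypothesis at `p` and NO `poitouTate_sha_tateDual`.
[cite: JetchevSkinnerWan2017, Thm. 3.3.1 (arXiv:1512.06894 p. 11)] [cite: MilneADT2006, Ch. I, Thm. 4.10(b)]
[cite: Kolyvagin1990, Thm. A] [cite: GrossLMS1991, §2] -/
theorem additiveControlLeOnTreeAt_of_poitouTate_of_heegner (hp2 : p ≠ 2) (hadd : Addv W p)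
    (N : ℕ) [NeZero N] (K : Type) [Field K] [NumberField K] (hPT : poitouTate_selmerStructure_duality K)
    (Dt : ModularParametrizationData W N) (H : HeegnerDatum N (NumberField.discr K)) (ι : K →+* ℂ)
    (P : (W.baseChange K).toAffine.Point) (hN : W.conductorNorm ℤ = N) (hK : IsImaginaryQuadratic K)
    (hHe : SatisfiesHeegnerHypothesis N K)
    (hP : WeierstrassCurve.Affine.Point.map ι.toRatAlgHom P = heegnerPointComplex Dt H)
    (hnt : ¬ IsOfFinAddOrder P) (hKo : Literature.NumberTheory.EllipticCurves.kolyvagin N W K)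
    (κ : ZpExtension K p) (hκ : κ.IsAnticyclotomic) (γ : Field.absoluteGaloisGroup K)
    [Fact (κ.IsTopGenerator γ)] (𝔭 : HeightOneSpectrum (𝓞 K)) (h𝔭 : ((p : ℕ) : 𝓞 K) ∈ 𝔭.asIdeal)
    (he : 𝔭.asIdeal.ramificationIdx (𝓞 ℚ) = 1) (hf : 𝔭.asIdeal.inertiaDeg (𝓞 ℚ) = 1) :
    AdditiveControlLeOnTreeAt p κ 𝔭 γ (embAt K p 𝔭 h𝔭 he hf) 0 P := by
  have hp : p.Prime := Fact.out
  have hpN : p ∣ W.conductorNorm ℤ :=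
    (W.dvd_conductorNorm_iff_not_hasGoodReductionAtPrime p).mpr (not_good_of_addv W p hadd)
  have hpN' : p ∣ N := hN ▸ hpN
  have hsplit : SplitsIn K p := hHe p hp hpN'
  have hunit : ¬ p ∣ Units.torsionOrder K :=
    (X11b.Three.not_dvd_discr_and_not_dvd_torsionOrder_of_heegner hK hHe hp2 hpN').2
  obtain ⟨hrank, hSha⟩ := hKo hK hHe ⟨Dt, H, ι, hP⟩ hnt
  exact additiveControlLeOnTreeAt_of_poitouTate_of_rankOne W p hp2 hadd hPT hK hsplit hunit hrank hSha P
    hnt κ hκ γ 𝔭 h𝔭 he hf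

/-- CTL₀ at every frame of a Heegner datum of an additive curve, from PT1 alone (Kolyvagin as antecedent).
[cite: GreenbergLNM1716, §4 Lemma 4.2 (p. 102)] [cite: Kolyvagin1990, Thm. A] -/
theorem exists_hasCharValuationAt_of_poitouTate_of_heegner (hp2 : p ≠ 2) (hadd : Addv W p)
    (N : ℕ) [NeZero N] (K : Type) [Field K] [NumberField K] (hPT : poitouTate_selmerStructure_duality K)
    (Dt : ModularParametrizationData W N) (H : HeegnerDatum N (NumberField.discr K)) (ι : K →+* ℂ)
    (P : (W.baseChange K).toAffine.Point) (hN : W.conductorNorm ℤ = N) (hK : IsImaginaryQuadratic K)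
    (hHe : SatisfiesHeegnerHypothesis N K)
    (hP : WeierstrassCurve.Affine.Point.map ι.toRatAlgHom P = heegnerPointComplex Dt H)
    (hnt : ¬ IsOfFinAddOrder P) (hKo : Literature.NumberTheory.EllipticCurves.kolyvagin N W K)
    (κ : ZpExtension K p) (hκ : κ.IsAnticyclotomic) (γ : Field.absoluteGaloisGroup K)
    [Fact (κ.IsTopGenerator γ)] (𝔭 : HeightOneSpectrum (𝓞 K)) (h𝔭 : ((p : ℕ) : 𝓞 K) ∈ 𝔭.asIdeal) :
    ∃ n : ℕ, XAc.HasCharValuationAt (W.baseChange K) p κ 𝔭 ∅ γ n := by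
  have hp : p.Prime := Fact.out
  have hpN : p ∣ W.conductorNorm ℤ :=
    (W.dvd_conductorNorm_iff_not_hasGoodReductionAtPrime p).mpr (not_good_of_addv W p hadd)
  have hsplit : SplitsIn K p := hHe p hp (hN ▸ hpN)
  obtain ⟨he, hf⟩ := degreeOne_of_splitsIn hK.1 hsplit h𝔭
  obtain ⟨n, hn, -⟩ := additiveControlLeOnTreeAt_of_poitouTate_of_heegner W p hp2 hadd N K hPT Dt H ι P
    hN hK hHe hP hnt hKo κ hκ γ 𝔭 h𝔭 he hf
  exact ⟨n, hn⟩

end Heegner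

/-! ## §3. The STEP L link with `≤`: T-B6-1 at slack `s` + the control inequality at slack `t` -/

section Links

variable {p : ℕ} [Fact p.Prime] {K : Type} [Field K] [NumberField K]
  {W : WeierstrassCurve ℚ} [W.IsElliptic] [W.IsGloballyMinimal] {κ : ZpExtension K p}
  {𝔭 : HeightOneSpectrum (𝓞 K)} {γ : Field.absoluteGaloisGroup K} [Fact (κ.IsTopGenerator γ)]
  {ι : K →+* ℚ_[p]} {P : (W.baseChange K).toAffine.Point} {s t : ℕ}

/-- **T-B6-1 at slack `s` ∧ the control INEQUALITY at slack `t` at one frame ⟹ the index inequality at slack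
`s + t` in frame currency**: `2·ord_p[E(K):ℤP] ≤ ord_p #Ш(E/K)[p^∞] + ord_p ∏_{w∣N⁺} c_w + 2(s + t)` — the two
characteristic generators' valuations agree (`XAc.HasCharValuationAt.unique`). The link consumes control ONLY
as `≤`. [cite: JetchevSkinnerWan2017, §7.4.1 (eq:shalowerK-1) (arXiv:1512.06894 p. 30)] -/
theorem index_le_of_imcLowerLe_of_controlLe (h1 : AdditiveIMCLowerBDPOnTreeLeAt p κ 𝔭 γ ι s P)
    (h2 : AdditiveControlLeOnTreeAt p κ 𝔭 γ ι t P) :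
    2 * (padicValNat p (AddSubgroup.zmultiples P).index : ℤ) ≤
      (padicValNat p (Nat.card (AddCommGroup.primaryComponent (W.baseChange K).sha p)) : ℤ) +
        padicValNat p (X11b.tamagawaProductSplit W K) + 2 * ((s + t : ℕ) : ℤ) := by
  obtain ⟨n, hn, hle⟩ := h1
  obtain ⟨n', hn', hle'⟩ := h2
  obtain rfl : n = n' := hn.unique hn'
  rw [Nat.cast_add]
  omega

/-- **STEP L at slack `s + t` from T-B6-1 at slack `s` and the control INEQUALITY at slack `t`** (read in
`SchneiderFree.IndexLowerBoundLeAt` currency over a Heegner field `K` for `N = N(E)` with `Ш(E/K)` finite: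
`2·ord_p[E(K):ℤP] ≤ ord_p #Ш(E/K) + 2·ord_p ∏_ℓ c_ℓ(E) + 2(s + t)`). The `≤`-form of K1's
`indexLowerBoundLeAt_of_imcLowerLe_of_control`: the LOWER index socket needs no control EQUALITY.
[cite: JetchevSkinnerWan2017, §7.4.1 (arXiv:1512.06894 p. 30)] -/
theorem indexLowerBoundLeAt_of_imcLowerLe_of_controlLe {N : ℕ} (hN : W.conductorNorm ℤ = N)
    (hK : IsImaginaryQuadratic K) (hHe : SatisfiesHeegnerHypothesis N K)
    (hfin : (W.baseChange K).ShaFinite) (h1 : AdditiveIMCLowerBDPOnTreeLeAt p κ 𝔭 γ ι s P)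
    (h2 : AdditiveControlLeOnTreeAt p κ 𝔭 γ ι t P) : IndexLowerBoundLeAt W p K P (s + t) :=
  (indexLowerBoundLeAt_iff_of_heegner_of_shaFinite hN hK hHe hfin).mpr
    (index_le_of_imcLowerLe_of_controlLe h1 h2)

/-- The slack-`0` control inequality case: T-B6-1 at slack `s` + `AdditiveControlLeOnTreeAt … 0 P` ⟹
`IndexLowerBoundLeAt W p K P s`. [cite: JetchevSkinnerWan2017, §7.4.1 (arXiv:1512.06894 p. 30)] -/
theorem indexLowerBoundLeAt_of_imcLowerLe_of_controlLe_zero {N : ℕ} (hN : W.conductorNorm ℤ = N)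
    (hK : IsImaginaryQuadratic K) (hHe : SatisfiesHeegnerHypothesis N K)
    (hfin : (W.baseChange K).ShaFinite) (h1 : AdditiveIMCLowerBDPOnTreeLeAt p κ 𝔭 γ ι s P)
    (h2 : AdditiveControlLeOnTreeAt p κ 𝔭 γ ι 0 P) : IndexLowerBoundLeAt W p K P s := by
  simpa using indexLowerBoundLeAt_of_imcLowerLe_of_controlLe hN hK hHe hfin h1 h2

/-- The control EQUALITY gives the control inequality at slack `0` (so every consumer of §1–§3 is also fed by
crux #5 / the K1 control crux). Bookkeeping. [folklore] -/
theorem additiveControlLeOnTreeAt_zero_of_onTreeAt (h : AdditiveControlOnTreeAt p κ 𝔭 γ ι P) :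
    AdditiveControlLeOnTreeAt p κ 𝔭 γ ι 0 P := by
  obtain ⟨n, hn, heq⟩ := h
  exact ⟨n, hn, by simp only [Nat.cast_zero, mul_zero, add_zero]; exact heq.le⟩

end Links

end Summit.BirchSwinnertonDyer.BirchSwinnertonDyer.Theorems.AdditiveRankOneControlLe

end
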